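import Summits.MatrixMultiplication.MatrixMultiplication.Theses.SnSubsetDichotomy
import Literature.NumberTheory.DiophantineGeometry.PartitionTableaux
import Literature.NumberTheory.DiophantineGeometry.SymmetricGroupReps
import Literature.NumberTheory.DiophantineGeometry.SymmetricGroupRepsFinrankSpechtProofs
import Literature.RepresentationTheory.FiniteGroups.WedderburnBlocks
import Literature.RepresentationTheory.FiniteGroups.UnitaryWedderburn
import Literature.RepresentationTheory.FiniteGroups.FourierInversionIdentity
import Literature.RepresentationTheory.FiniteGroups.SymmetricGroupIsotypic
import Literature.RepresentationTheory.FiniteGroups.VershikKerovMaxDegreeProofs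
import Literature.Combinatorics.Additive.TPPGroupAlgebra
import Literature.Barriers.MatrixMultiplication.QuasirandomBarrierProofs
import Literature.Barriers.ValiantsHypothesis.GCTMatrixPoweringProp17OnlyIf

/-!
# Stub `stub_blockDictionary` (crux stmt-MatrixMultiplication-8303, line flat-tail-truncation)

Crux `Summit.MatrixMultiplication.MatrixMultiplication.Theses.SnSubsetDichotomy.GlobalBranch`, line
`flat-tail-truncation`: the dictionary between the Wedderburn blocks of `ℂ[𝔖ₙ]` and the partitions
of `n`.

For a unitary Wedderburn decomposition `φ : ℂ[𝔖ₙ] ≃ₐ ∏ᵢ ℂ^{dᵢ×dᵢ}` we prove that there is a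
bijection `part : Fin r → Nat.Partition n` with

* `χ_i = χ^{part i}`: the character of the `i`-th block representation (`blockRep φ i`, irreducible
  by `isIrreducible_blockRep`) is the Specht character of `part i` (the irreducible characters of
  `𝔖ₙ` are the Specht characters, `irrChars_perm_eq`; `part` is injective by
  `character_blockRep_injective` and `spechtCharacter` injective, surjective by the count
  `Σᵢ dᵢ² = n! = Σ_μ (f^μ)²`, `sum_sq_blockDegrees_eq_card`, `sum_sq_numStandardTableaux`,
  `numStandardTableaux_pos_holds`);
* `dᵢ = f^{part i}` (evaluate the characters at `1`: `χ_i(1) = dᵢ`, `χ^μ(1) = dim S^μ = f^μ`,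
  `finrank_spechtIdeal_holds`);
* the trivial block (`dᵢ = 1`, `φ(g)ᵢ = 1` for all `g`) is indexed by `(n) = Nat.Partition.indiscrete n`
  (`χ^{(n)} ≡ 1`, `spechtCharacter_indiscrete`, and `spechtCharacter_injective`);
* the Hilbert–Schmidt norm of the `i`-th block of `1̂_X = φ(𝟙_X)` is the character sum
  `Re tr(φ(𝟙_X)ᵢᴴ φ(𝟙_X)ᵢ) = Σ_{x,y ∈ X} Re χ^{part i}(x⁻¹y)` (`φ(𝟙_X)ᵢᴴ = φ(𝟙_{X⁻¹})ᵢ` by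
  unitarity, `algEquiv_indicatorElemInv_eq_conjTranspose`, and `tr φ(g)ᵢ = χ_i(g)`,
  `character_blockRep_apply`).
-/

set_option linter.dupNamespace false

open scoped BigOperators Matrix ComplexOrder
open Finset
open Literature.Combinatorics.Additive (TripleProductProperty indicatorElem indicatorElemInv)
open Literature.NumberTheory.DiophantineGeometry (numStandardTableaux spechtCharacter)
open Literature.RepresentationTheory.FiniteGroups (BlockAlgebraC blockRep)

namespace Summit.MatrixMultiplication.MatrixMultiplication.Theorems.GlobalBranch

open Literature.Combinatorics.Additive Literature.RepresentationTheory.FiniteGroups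
  Literature.Barriers.MatrixMultiplication
open Literature.NumberTheory.DiophantineGeometry (finrank_spechtIdeal_holds
  numStandardTableaux_pos_holds)

section Dictionary

variable {n r : ℕ} {d : Fin r → ℕ}

/-- The character of every Wedderburn block of `ℂ[𝔖ₙ]` is a Specht character `χ^μ`
(the block representation is irreducible, and the irreducible characters of `𝔖ₙ` are the
`χ^μ`, `μ ⊢ n`). [folklore] -/
theorem blockDictionary_exists_spechtCharacter_eq [∀ i, NeZero (d i)]
    (φ : MonoidAlgebra ℂ (Equiv.Perm (Fin n)) ≃ₐ[ℂ] BlockAlgebraC d) (i : Fin r) :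
    ∃ μ : Nat.Partition n, spechtCharacter ℂ μ = (blockRep φ i).character := by
  have hmem : (blockRep φ i).character ∈ irrChars (Equiv.Perm (Fin n)) :=
    ⟨Fin (d i) → ℂ, inferInstance, inferInstance, inferInstance, blockRep φ i,
      isIrreducible_blockRep φ i, rfl⟩
  rw [irrChars_perm_eq, Set.mem_range] at hmem
  exact hmem

/-- The block characters take the value `dᵢ` at `1`. [folklore] -/
theorem blockDictionary_character_blockRep_one
    (φ : MonoidAlgebra ℂ (Equiv.Perm (Fin n)) ≃ₐ[ℂ] BlockAlgebraC d) (i : Fin r) :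
    (blockRep φ i).character 1 = (d i : ℂ) := by
  rw [Representation.char_one, Module.finrank_fintype_fun_eq_card, Fintype.card_fin]

/-- `χ^μ(1) = f^μ` (`dim S^μ = f^μ`). [folklore] -/
theorem blockDictionary_spechtCharacter_one (μ : Nat.Partition n) :
    spechtCharacter ℂ μ 1 = (numStandardTableaux μ : ℂ) := by
  rw [spechtCharacter, Representation.char_one, finrank_spechtIdeal_holds ℂ μ]

/-- If the `i`-th block character is `χ^μ` then `dᵢ = f^μ`. [folklore] -/
theorem blockDictionary_degree_eq
    (φ : MonoidAlgebra ℂ (Equiv.Perm (Fin n)) ≃ₐ[ℂ] BlockAlgebraC d) (i : Fin r)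
    (μ : Nat.Partition n) (h : spechtCharacter ℂ μ = (blockRep φ i).character) :
    d i = numStandardTableaux μ := by
  have h1 := blockDictionary_spechtCharacter_one μ
  rw [h, blockDictionary_character_blockRep_one] at h1
  exact_mod_cast h1

/-- A labelling of the blocks by partitions matching the characters is injective (different
blocks have different characters). [folklore] -/
theorem blockDictionary_injective [∀ i, NeZero (d i)]
    (φ : MonoidAlgebra ℂ (Equiv.Perm (Fin n)) ≃ₐ[ℂ] BlockAlgebraC d)
    (part : Fin r → Nat.Partition n)
    (hpart : ∀ i, spechtCharacter ℂ (part i) = (blockRep φ i).character) :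
    Function.Injective part := by
  intro i j hij
  have h : (blockRep φ i).character = (blockRep φ j).character := by
    rw [← hpart i, ← hpart j, hij]
  exact character_blockRep_injective φ h

/-- A labelling of the blocks by partitions matching the characters is surjective: by
injectivity and `dᵢ = f^{part i}`, `Σ_{μ ∈ image} (f^μ)² = Σᵢ dᵢ² = n! = Σ_μ (f^μ)²`, and every
`f^μ ≥ 1`, so no partition is missed. [folklore] -/
theorem blockDictionary_surjective [∀ i, NeZero (d i)]
    (φ : MonoidAlgebra ℂ (Equiv.Perm (Fin n)) ≃ₐ[ℂ] BlockAlgebraC d)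
    (part : Fin r → Nat.Partition n)
    (hpart : ∀ i, spechtCharacter ℂ (part i) = (blockRep φ i).character) :
    Function.Surjective part := by
  classical
  have hinj := blockDictionary_injective φ part hpart
  intro μ₀
  by_contra hμ₀
  have hsum1 : ∑ i, d i ^ 2 = n.factorial := by
    rw [sum_sq_blockDegrees_eq_card φ, Nat.card_eq_fintype_card, Fintype.card_perm,
      Fintype.card_fin]
  have himage : ∑ i, d i ^ 2 = ∑ μ ∈ univ.image part, numStandardTableaux μ ^ 2 := by
    rw [Finset.sum_image fun i _ j _ h => hinj h]
    exact Finset.sum_congr rfl fun i _ => by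
      rw [blockDictionary_degree_eq φ i (part i) (hpart i)]
  have hnot : μ₀ ∉ univ.image part := by
    rw [Finset.mem_image]
    rintro ⟨i, -, hi⟩
    exact hμ₀ ⟨i, hi⟩
  have hlt : ∑ μ ∈ univ.image part, numStandardTableaux μ ^ 2 <
      ∑ μ, numStandardTableaux μ ^ 2 :=
    Finset.sum_lt_sum_of_subset (Finset.subset_univ _) (Finset.mem_univ μ₀) hnot
      (pow_pos (numStandardTableaux_pos_holds μ₀) 2) fun _ _ _ => Nat.zero_le _
  rw [← himage, hsum1, sum_sq_numStandardTableaux n] at hlt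
  exact lt_irrefl _ hlt

/-- The trivial block is indexed by the one-row partition: if `dᵢ = 1` and every `g` acts as `1`
on block `i`, then `χ_i ≡ 1 = χ^{(n)}`, so `part i = (n)`. [folklore] -/
theorem blockDictionary_trivial_block
    (φ : MonoidAlgebra ℂ (Equiv.Perm (Fin n)) ≃ₐ[ℂ] BlockAlgebraC d)
    (part : Fin r → Nat.Partition n)
    (hpart : ∀ i, spechtCharacter ℂ (part i) = (blockRep φ i).character) (i : Fin r)
    (hdi : d i = 1) (hg : ∀ g : Equiv.Perm (Fin n), φ (MonoidAlgebra.single g 1) i = 1) :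
    part i = Nat.Partition.indiscrete n := by
  apply spechtCharacter_injective
  show spechtCharacter ℂ (part i) = spechtCharacter ℂ (Nat.Partition.indiscrete n)
  rw [hpart i]
  funext g
  rw [character_blockRep_apply, hg g, Matrix.trace_one, Fintype.card_fin, hdi,
    Literature.Barriers.ValiantsHypothesis.spechtCharacter_indiscrete, Nat.cast_one]

/-- **Hilbert–Schmidt norm of a block of `1̂_X` as a character sum**: under a unitary
decomposition, `Re tr(φ(𝟙_X)ᵢᴴ φ(𝟙_X)ᵢ) = Σ_{x,y ∈ X} Re χ_i(x⁻¹ y)`. [folklore] -/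
theorem blockDictionary_norm_eq_charSum
    (φ : MonoidAlgebra ℂ (Equiv.Perm (Fin n)) ≃ₐ[ℂ] BlockAlgebraC d)
    (hφ : ∀ (g : Equiv.Perm (Fin n)) (i : Fin r),
      (φ (MonoidAlgebra.single g 1) i)ᴴ * φ (MonoidAlgebra.single g 1) i = 1)
    (i : Fin r) (X : Finset (Equiv.Perm (Fin n))) :
    ((φ (indicatorElem ℂ X) i)ᴴ * φ (indicatorElem ℂ X) i).trace.re =
      ∑ x ∈ X, ∑ y ∈ X, ((blockRep φ i).character (x⁻¹ * y)).re := by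
  have hmul : φ (indicatorElemInv ℂ X * indicatorElem ℂ X) i =
      (φ (indicatorElem ℂ X) i)ᴴ * φ (indicatorElem ℂ X) i := by
    rw [map_mul, Pi.mul_apply, algEquiv_indicatorElemInv_eq_conjTranspose φ hφ]
  rw [← hmul, indicatorElemInv_def, indicatorElem_def, Finset.sum_mul_sum]
  simp only [MonoidAlgebra.single_mul_single, mul_one]
  rw [map_sum, Finset.sum_apply, Matrix.trace_sum, Complex.re_sum]
  refine Finset.sum_congr rfl fun x _ => ?_
  rw [map_sum, Finset.sum_apply, Matrix.trace_sum, Complex.re_sum]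
  refine Finset.sum_congr rfl fun y _ => ?_
  rw [character_blockRep_apply]

end Dictionary

/-- **Dictionary between the Wedderburn blocks of `ℂ[𝔖ₙ]` and the partitions of `n`**: for a
unitary decomposition `φ : ℂ[𝔖ₙ] ≃ₐ ∏ᵢ ℂ^{dᵢ×dᵢ}` there is a bijection `part` from blocks to
partitions with `χ_i = χ^{part i}`, `dᵢ = f^{part i}`, the trivial block indexed by `(n)`, and the
Hilbert–Schmidt norm of the `i`-th block of `φ(𝟙_X)` equal to `Σ_{x,y ∈ X} Re χ^{part i}(x⁻¹y)`. -/
theorem stub_blockDictionary (n : ℕ) {r : ℕ} {d : Fin r → ℕ} [∀ i, NeZero (d i)]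
    (φ : MonoidAlgebra ℂ (Equiv.Perm (Fin n)) ≃ₐ[ℂ] BlockAlgebraC d)
    (hφ : ∀ (g : Equiv.Perm (Fin n)) (i : Fin r),
      (φ (MonoidAlgebra.single g 1) i)ᴴ * φ (MonoidAlgebra.single g 1) i = 1) :
    ∃ part : Fin r → Nat.Partition n, Function.Bijective part ∧
      (∀ i, (blockRep φ i).character = spechtCharacter ℂ (part i)) ∧
      (∀ i, d i = numStandardTableaux (part i)) ∧
      (∀ i, d i = 1 → (∀ g : Equiv.Perm (Fin n), φ (MonoidAlgebra.single g 1) i = 1) →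
        part i = Nat.Partition.indiscrete n) ∧
      (∀ (i : Fin r) (X : Finset (Equiv.Perm (Fin n))),
        ((φ (indicatorElem ℂ X) i)ᴴ * φ (indicatorElem ℂ X) i).trace.re =
          ∑ x ∈ X, ∑ y ∈ X, (spechtCharacter ℂ (part i) (x⁻¹ * y)).re) := by
  choose part hpart using blockDictionary_exists_spechtCharacter_eq φ
  refine ⟨part, ⟨blockDictionary_injective φ part hpart, blockDictionary_surjective φ part hpart⟩,
    fun i => (hpart i).symm, fun i => blockDictionary_degree_eq φ i (part i) (hpart i),
    fun i hdi hg => blockDictionary_trivial_block φ part hpart i hdi hg, fun i X => ?_⟩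
  rw [blockDictionary_norm_eq_charSum φ hφ i X, ← hpart i]

end Summit.MatrixMultiplication.MatrixMultiplication.Theorems.GlobalBranch
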